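import Summits.QuantumFields.YangMills.Theorems.BalabanLadderUVSeamRecCeilingsLevelCaps
import Summits.QuantumFields.YangMills.Theorems.BalabanLadderUVSeamRecCeilingsPolymerRarityLevelwise
import Summits.QuantumFields.YangMills.Theorems.BalabanLadderUVSeamRecCeilingsResponseCarriersInfluence
import HarnessLib

/-!
# Crux `UVSeamRec` (stmt-QuantumFields-20043), v5(α) stub `stub_responseMomentsOdd6` (RM): the (β) press-button with PER-LEVEL,
# period-free product laws — the large-field half of the (β) architecture needs NO cross-level joint law, with the SAME constants

Helper file (`--supports stmt-QuantumFields-20043`) of the width-lever seat `ym-20043-ceilings-p2` (lane B, gen 3); assembles this seat's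
`…CeilingsPolymerRarityLevelwise.lean` (generalised Hölder across levels), `…CeilingsLevelCaps.lean` (level caps `Λ_k = 16(b^k/(R+2+2b^k))⁴`,
`Σ_k Λ_k ≤ 1`, the period fold of one level) and g2's p543486/p541829 (the (β) press-button in tempered-d1's letters).

WHAT.  p543486 (and its period-free refinement `…ResponseCarriersPeriodic`, this seat) asks for ONE product law over the whole multiscale family
shell — a JOINT law across nested scales.  With the natural weights such a joint law does NOT follow from per-level laws (block fields at nested
scales are positively correlated: for a level-`(k+1)` block-plaquette `γ₁` over a level-`k` one `γ₀`, `μ(E_{γ₁} ∩ E_{γ₀})` can be `≈ μ(E_{γ₀}) ≫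
δ_{k+1}δ_k`), whereas PER-LEVEL laws are what a scale-by-scale analysis outputs (and level `0` is PROVED: p530009).  THIS FILE: the doubled joint
exponential moments of tempered-d1's multiscale influence functionals, hence (RM), follow from PER-LEVEL PERIOD-FREE product laws with a single
total density budget `W` — and the constant is the SAME `B = A₀ + max(B_Q, 2e²W)` as with the joint law: Hölder across levels with exponents
`p_k = (Σ_j Λ_j)/Λ_k` costs `e^{2 p_k Λ_k} = e^{2Σ_jΛ_j} ≤ e²` per level, and the per-cube budgets add over the levels.

* `torusE_exp_two_mul_sum_influence_le_of_levelwise` — on the odd torus `2L+1`, cube family cyclically `2R+4`-separated, `4R+8 ≤ L`: weights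
  `w ≥ 0` on the family shell with total budget `Σ_γ familyCoeff i γ · w γ ≤ W` and, FOR EACH LEVEL `k`, the product law for the period-free
  subfamilies of the level-`k` part of the family shell ⇒ `⟨exp(2 Σ_{i∈T} influence 𝔟 ε kmax R (x i)∘lift)⟩ ≤ exp(2e²W·#T)`.
* `responseMoments_of_quadratic_and_influence_levelwise` — (split with `Q + influenceAt 𝔟 ε kmax`) + (EM_Q) + levelwise period-free laws ⇒ (RM),
  `B = A₀ + max(B_Q, 2e²W)`; `responseMomentsOdd6_of_quadratic_and_influence_levelwise` — the registered-stub twin (SU(2), fundamental, unit of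
  record).

So the located residual of (S-A) along (β) reads: {the split law, (EM_Q), and FOR EACH LEVEL `k ≥ 1` SEPARATELY a period-free product law for the
level-`k` block-plaquettes of the family shells with level weights whose total budget `Σ_k Σ_{γ level k} familyCoeff·w` is `β`-uniformly
bounded} — level `0` being the tree's Peierls gas of large plaquettes.  HONEST FRAMING: composition; (split), (EM_Q) and the level-`k ≥ 1` laws
are OPEN renormalisation-group statements on odd tori; nothing of E0′; not a gap, not Clay.

References: folklore (generalised Hölder); H.-O. Georgii, *Gibbs Measures and Phase Transitions* (2011) Thm. 4.17 (DLR part, via p535725);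
T. Bałaban, Commun. Math. Phys. 122 (1989) 355–392 (intended supplier of the level laws).
-/

set_option autoImplicit false

noncomputable section

open MeasureTheory Filter Topology Finset
open Literature.Probability.LatticeModels
open Literature.MathematicalPhysics.QuantumFieldTheory (GaugeConfig wilsonMeasure isProbabilityMeasure_wilsonMeasure
  measurable_torusLift LatticeRep)
open Literature.MathematicalPhysics.QuantumLattice

namespace Summit.QuantumFields.YangMills.Cruxes.UVSeamRec.TemperedResponse

open Summit.QuantumFields.YangMills.Cruxes.OSLegsFromFemtoAndGap.DlrCollarTransfer
open Summit.QuantumFields.YangMills.Cruxes.UVSeamRec.PolymerData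
open Summit.QuantumFields.YangMills.Cruxes.UVSeamRec.PolymerRarity (integral_exp_mul_sum_levels_le_card indicator_one_preimage)
open Summit.QuantumFields.YangMills.Cruxes.UVSeamRec.DefectCollar (integral_prod_indicator_eq_measureReal)

/-! ## §1 The doubled joint exponential moments of the multiscale influence functionals from per-level laws -/

section Levelwise

variable {N : ℕ} [NeZero N]

/-- Polymers of the family shell live on the levels `k ≤ kmax` with `2b^k ≤ R` (shell condition `R+2+2b^k ≤ dist ≤ 2R+2`). [folklore] -/
theorem level_mem_of_mem_familyShell (𝔟 : BlockSize) (kmax R : ℕ) {n : ℕ} (x : Fin n → (Fin 4 → ℤ)) {γ : Polymer}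
    (hγ : γ ∈ familyShell 𝔟 kmax R x) :
    γ.k ∈ (Finset.range (kmax + 1)).filter (fun k => 2 * 𝔟.b ^ k ≤ R) := by
  obtain ⟨i, _, hi⟩ := Finset.mem_biUnion.1 hγ
  have h := (mem_shell_iff 𝔟 kmax R (x i) γ).1 hi
  refine Finset.mem_filter.2 ⟨Finset.mem_range.2 (Nat.lt_succ_of_le h.1), ?_⟩
  have := h.2.1.trans h.2.2
  omega

/-- **DOUBLED JOINT EXPONENTIAL MOMENTS OF THE MULTISCALE INFLUENCE FUNCTIONALS FROM PER-LEVEL PERIOD-FREE PRODUCT LAWS.**  Structure group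
`SU(N)`, any lattice representation `r`, block size `𝔟`, thresholds `ε`, cutoff `kmax`, odd torus `2L+1`, cube family `x` pairwise cyclically
`2R+4`-separated with `4R+8 ≤ L`; weights `w γ ≥ 0` on the family shell with TOTAL density budget `Σ_γ familyCoeff i γ · w γ ≤ W` (all `i`), and FOR
EACH LEVEL `k` the product law `⟨∏_{γ∈A} 1_{largeFieldEvent 𝔟 (ε k) γ}∘lift⟩ ≤ ∏_{γ∈A} w γ` for the PERIOD-FREE subfamilies `A` of the level-`k` part of
the family shell.  THEN for every index set `T`: `⟨exp(2 Σ_{i∈T} influence 𝔟 ε kmax R (x i)∘lift)⟩_{2L+1,β} ≤ exp(2e²·W·#T)` — the bound p535725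
derives from the JOINT law with `Λ = 1`.  Proof: fold each level (`exists_polymerSystem_of_periodFree_sub` with the level cap), then the
levelwise Hölder composition `integral_exp_mul_sum_levels_le_card` with `Σ_k Λ_k ≤ 1` (`sum_levelCap_le_one`). [folklore] -/
theorem torusE_exp_two_mul_sum_influence_le_of_levelwise (r : LatticeRep (Matrix.specialUnitaryGroup (Fin N) ℂ))
    (𝔟 : BlockSize) (ε : ℕ → ℝ) (kmax R L : ℕ) (β : ℝ) {n : ℕ} (x : Fin n → (Fin 4 → ℤ)) (hRL : 4 * R + 8 ≤ L)
    (hsep : ∀ i j : Fin n, i ≠ j → ∃ k : Fin 4,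
      (2 * (R : ℤ) + 4) ≤ |((((x i k - x j k : ℤ) : ZMod (2 * L + 1))).valMinAbs : ℤ)|)
    {W : ℝ} (w : Polymer → ℝ) (hw0 : ∀ γ ∈ familyShell 𝔟 kmax R x, 0 ≤ w γ)
    (hwW : ∀ i, ∑ γ ∈ familyShell 𝔟 kmax R x, familyCoeff 𝔟 kmax R x i γ * w γ ≤ W)
    (hpl : ∀ k : ℕ, ∀ A, A ⊆ (familyShell 𝔟 kmax R x).filter (fun γ => γ.k = k) →
      Set.InjOn (fun γ : Polymer => (γ.k, Torus.proj (2 * L + 1) (anchor 𝔟 γ), γ.μ, γ.ν)) ↑A →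
      torusE (Matrix.specialUnitaryGroup (Fin N) ℂ) r β L (fun U => ∏ γ ∈ A,
        (largeFieldEvent (N := N) 𝔟 (ε γ.k) γ).indicator (fun _ => (1 : ℝ)) U) ≤ ∏ γ ∈ A, w γ)
    (T : Finset (Fin n)) :
    torusE (Matrix.specialUnitaryGroup (Fin N) ℂ) r β L
        (fun U => Real.exp (((2 : ℕ) : ℝ) * ∑ i ∈ T, influence (N := N) 𝔟 ε kmax R (x i) U)) ≤
      Real.exp (2 * Real.exp (2 * 1) * W * T.card) := by
  classical
  haveI := isProbabilityMeasure_wilsonMeasure (d := 4) (L := 2 * L + 1) r.ρ r.continuous β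
  set fS : Finset Polymer := familyShell 𝔟 kmax R x with hfS
  set Kl : Finset ℕ := (Finset.range (kmax + 1)).filter (fun k => 2 * 𝔟.b ^ k ≤ R) with hKl
  set cap : ℕ → ℝ := fun k => 16 * ((𝔟.b : ℝ) ^ k / ((R : ℝ) + 2 + 2 * (𝔟.b : ℝ) ^ k)) ^ 4 with hcapdef
  -- the per-level folds
  have hfold : ∀ k ∈ Kl, ∃ (S : Finset Polymer) (c : Fin n → Polymer → ℝ),
      S ⊆ fS.filter (fun γ => γ.k = k) ∧ (∀ i, ∀ γ ∈ S, 0 ≤ c i γ) ∧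
      (∀ (i : Fin n) (U : GaugeConfig 4 (2 * L + 1) (Matrix.specialUnitaryGroup (Fin N) ℂ)),
        ∑ γ ∈ fS.filter (fun γ => γ.k = k), familyCoeff 𝔟 kmax R x i γ *
            (largeFieldEvent (N := N) 𝔟 (ε γ.k) γ).indicator (fun _ => (1 : ℝ)) (torusLift (2 * L + 1) U) ≤
          ∑ γ ∈ S, c i γ * (largeFieldEvent (N := N) 𝔟 (ε γ.k) γ).indicator (fun _ => (1 : ℝ))
            (torusLift (2 * L + 1) U)) ∧
      (∀ γ ∈ S, ∑ i, c i γ ≤ cap k) ∧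
      (∀ i, ∑ γ ∈ S, c i γ * w γ ≤ ∑ γ ∈ fS.filter (fun γ => γ.k = k), familyCoeff 𝔟 kmax R x i γ * w γ) ∧
      (∀ A, A ⊆ S → torusE (Matrix.specialUnitaryGroup (Fin N) ℂ) r β L (fun U => ∏ γ ∈ A,
        (largeFieldEvent (N := N) 𝔟 (ε γ.k) γ).indicator (fun _ => (1 : ℝ)) U) ≤ ∏ γ ∈ A, w γ) := by
    intro k _
    refine exists_polymerSystem_of_periodFree_sub (N := N) r 𝔟 ε kmax R L β x (fS.filter (fun γ => γ.k = k)) ?_ w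
      (hpl k)
    intro v
    by_cases hv : v.1 = k
    · have h := sum_sum_fiber_familyCoeff_le_levelCap 𝔟 kmax R hRL x hsep (fS.filter (fun γ => γ.k = k)) v
      rw [hv] at h
      exact h
    · have hempty : (fS.filter (fun γ => γ.k = k)).filter
          (fun γ => (γ.k, Torus.proj (2 * L + 1) (anchor 𝔟 γ), γ.μ, γ.ν) = v) = ∅ := by
        refine Finset.eq_empty_of_forall_notMem fun γ hγ => hv ?_
        have h1 := Finset.mem_filter.1 hγ
        have h2 := (Finset.mem_filter.1 h1.1).2
        rw [← h1.2]
        exact h2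
      simp only [hempty, Finset.sum_empty, Finset.sum_const_zero, hcapdef]
      positivity
  choose! Sf cf hSsub hc0 hdom hcap hbud hplS using hfold
  -- the polymer events read on the torus
  set E' : Polymer → Set (GaugeConfig 4 (2 * L + 1) (Matrix.specialUnitaryGroup (Fin N) ℂ)) :=
    fun γ => (torusLift (2 * L + 1)) ⁻¹' (largeFieldEvent (N := N) 𝔟 (ε γ.k) γ) with hE'def
  have hE' : ∀ γ, MeasurableSet (E' γ) := fun γ => measurable_torusLift _ (measurableSet_largeFieldEvent (N := N) 𝔟 _ γ)
  -- the common coefficient function: the level is read off the polymer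
  set a : Fin n → Polymer → ℝ := fun i γ => cf γ.k i γ with hadef
  have hlev : ∀ k ∈ Kl, ∀ γ ∈ Sf k, γ.k = k := fun k hk γ hγ => (Finset.mem_filter.1 (hSsub k hk hγ)).2
  have ha_eq : ∀ k ∈ Kl, ∀ i, ∀ γ ∈ Sf k, a i γ = cf k i γ := fun k hk i γ hγ => by
    simp only [hadef, hlev k hk γ hγ]
  -- hypotheses of the levelwise Hölder composition
  have hw' : ∀ k ∈ Kl, ∀ γ ∈ Sf k, 0 ≤ w γ := fun k hk γ hγ => hw0 γ (Finset.mem_filter.1 (hSsub k hk hγ)).1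
  have ha' : ∀ k ∈ Kl, ∀ i ∈ T, ∀ γ ∈ Sf k, 0 ≤ a i γ := fun k hk i _ γ hγ => by
    rw [ha_eq k hk i γ hγ]; exact hc0 k hk i γ hγ
  have hcap_pos : ∀ k ∈ Kl, 0 < cap k := fun k _ => by
    simp only [hcapdef]
    have := 𝔟.pos
    positivity
  have hΛl : ∀ k ∈ Kl, ∀ γ ∈ Sf k, ∑ i ∈ T, a i γ ≤ cap k := by
    intro k hk γ hγ
    have h1 : ∑ i ∈ T, a i γ ≤ ∑ i, a i γ :=
      Finset.sum_le_univ_sum_of_nonneg fun i => by rw [ha_eq k hk i γ hγ]; exact hc0 k hk i γ hγ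
    refine h1.trans ?_
    rw [Finset.sum_congr rfl fun i _ => ha_eq k hk i γ hγ]
    exact hcap k hk γ hγ
  have hΛsum : ∑ k ∈ Kl, cap k ≤ 1 := sum_levelCap_le_one 𝔟 kmax R
  have hmaps : ∀ γ ∈ fS, γ.k ∈ Kl := fun γ hγ => level_mem_of_mem_familyShell 𝔟 kmax R x hγ
  have hWtot : ∀ i ∈ T, ∑ k ∈ Kl, ∑ γ ∈ Sf k, a i γ * w γ ≤ W := by
    intro i _
    calc ∑ k ∈ Kl, ∑ γ ∈ Sf k, a i γ * w γ
        ≤ ∑ k ∈ Kl, ∑ γ ∈ fS.filter (fun γ => γ.k = k), familyCoeff 𝔟 kmax R x i γ * w γ := by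
          refine Finset.sum_le_sum fun k hk => ?_
          rw [Finset.sum_congr rfl fun γ hγ => by rw [ha_eq k hk i γ hγ]]
          exact hbud k hk i
      _ = ∑ γ ∈ fS, familyCoeff 𝔟 kmax R x i γ * w γ := Finset.sum_fiberwise_of_maps_to hmaps _
      _ ≤ W := hwW i
  have hPL' : ∀ k ∈ Kl, ∀ A, A ⊆ Sf k →
      (wilsonMeasure (d := 4) (L := 2 * L + 1) r.ρ β).real (⋂ γ ∈ A, E' γ) ≤ ∏ γ ∈ A, w γ := by
    intro k hk A hA
    rw [← integral_prod_indicator_eq_measureReal _ A E' hE']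
    have h1 := hplS k hk A hA
    simp only [torusE] at h1
    simp_rw [hE'def, indicator_one_preimage]
    exact h1
  have key := integral_exp_mul_sum_levels_le_card (wilsonMeasure (d := 4) (L := 2 * L + 1) r.ρ β) T Kl Sf E' hE'
    w hw' a ha' (lam := 2) (Λ := 1) (W := W) (by norm_num) cap hcap_pos hΛl hΛsum hWtot hPL'
  -- compare the tilts pointwise: `influence_i∘lift ≤ Σ_k Σ_{γ ∈ Sf k} a_{iγ} 1_{E'_γ}`
  have hdom' : ∀ (i : Fin n) (U : GaugeConfig 4 (2 * L + 1) (Matrix.specialUnitaryGroup (Fin N) ℂ)),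
      influence (N := N) 𝔟 ε kmax R (x i) (torusLift (2 * L + 1) U) ≤
        ∑ k ∈ Kl, ∑ γ ∈ Sf k, a i γ * (E' γ).indicator (fun _ => (1 : ℝ)) U := by
    intro i U
    rw [influence_eq_familySum (N := N) 𝔟 ε kmax R x i, ← Finset.sum_fiberwise_of_maps_to hmaps]
    refine Finset.sum_le_sum fun k hk => (hdom k hk i U).trans (le_of_eq ?_)
    refine Finset.sum_congr rfl fun γ hγ => ?_
    rw [ha_eq k hk i γ hγ, hE'def, indicator_one_preimage]
  have hlinm : Measurable fun U : GaugeConfig 4 (2 * L + 1) (Matrix.specialUnitaryGroup (Fin N) ℂ) =>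
      (2 : ℝ) * ∑ i ∈ T, ∑ k ∈ Kl, ∑ γ ∈ Sf k, a i γ * (E' γ).indicator (fun _ => (1 : ℝ)) U :=
    (Finset.measurable_sum T fun i _ => Finset.measurable_sum Kl fun k _ => Finset.measurable_sum (Sf k) fun γ _ =>
      (measurable_const.indicator (hE' γ)).const_mul _).const_mul _
  have hχ : ∀ γ (U : GaugeConfig 4 (2 * L + 1) (Matrix.specialUnitaryGroup (Fin N) ℂ)),
      |(E' γ).indicator (fun _ => (1 : ℝ)) U| ≤ 1 := fun γ U => by
    rw [abs_of_nonneg (Set.indicator_nonneg (fun _ _ => zero_le_one) _)]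
    exact Set.indicator_apply_le' (fun _ => le_rfl) (fun _ => zero_le_one)
  have hintlin : Integrable (fun U : GaugeConfig 4 (2 * L + 1) (Matrix.specialUnitaryGroup (Fin N) ℂ) =>
      Real.exp ((2 : ℝ) * ∑ i ∈ T, ∑ k ∈ Kl, ∑ γ ∈ Sf k, a i γ * (E' γ).indicator (fun _ => (1 : ℝ)) U))
      (wilsonMeasure (d := 4) (L := 2 * L + 1) r.ρ β) := by
    refine integrable_of_abs_le hlinm.exp (C := Real.exp (2 * ∑ i ∈ T, ∑ k ∈ Kl, ∑ γ ∈ Sf k, |a i γ|)) fun U => ?_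
    rw [Real.abs_exp]
    refine Real.exp_le_exp.2 (mul_le_mul_of_nonneg_left ?_ (by norm_num))
    refine Finset.sum_le_sum fun i _ => Finset.sum_le_sum fun k _ => Finset.sum_le_sum fun γ _ => ?_
    calc a i γ * (E' γ).indicator (fun _ => (1 : ℝ)) U ≤ |a i γ * (E' γ).indicator (fun _ => (1 : ℝ)) U| :=
          le_abs_self _
      _ = |a i γ| * |(E' γ).indicator (fun _ => (1 : ℝ)) U| := abs_mul _ _
      _ ≤ |a i γ| * 1 := mul_le_mul_of_nonneg_left (hχ γ U) (abs_nonneg _)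
      _ = |a i γ| := mul_one _
  have hexp : ∀ U : GaugeConfig 4 (2 * L + 1) (Matrix.specialUnitaryGroup (Fin N) ℂ),
      Real.exp (((2 : ℕ) : ℝ) * ∑ i ∈ T, influence (N := N) 𝔟 ε kmax R (x i) (torusLift (2 * L + 1) U)) ≤
        Real.exp ((2 : ℝ) * ∑ i ∈ T, ∑ k ∈ Kl, ∑ γ ∈ Sf k, a i γ * (E' γ).indicator (fun _ => (1 : ℝ)) U) :=
    fun U => by
    refine Real.exp_le_exp.2 ?_
    rw [Nat.cast_ofNat]
    exact mul_le_mul_of_nonneg_left (Finset.sum_le_sum fun i _ => hdom' i U) (by norm_num)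
  calc torusE (Matrix.specialUnitaryGroup (Fin N) ℂ) r β L
        (fun U => Real.exp (((2 : ℕ) : ℝ) * ∑ i ∈ T, influence (N := N) 𝔟 ε kmax R (x i) U))
      ≤ ∫ U, Real.exp ((2 : ℝ) * ∑ i ∈ T, ∑ k ∈ Kl, ∑ γ ∈ Sf k, a i γ * (E' γ).indicator (fun _ => (1 : ℝ)) U)
          ∂(wilsonMeasure (d := 4) (L := 2 * L + 1) r.ρ β) := by
        unfold torusE
        exact integral_mono_of_nonneg (ae_of_all _ fun U => (Real.exp_pos _).le) hintlin (ae_of_all _ fun U => hexp U)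
    _ ≤ Real.exp (2 * Real.exp (2 * 1) * W * T.card) := key

end Levelwise

/-! ## §2 The (β) press-button with per-level period-free product laws -/

section Influence

variable {N : ℕ} [NeZero N]

/-- **(RM) from a quadratic carrier and tempered-d1's influence functional — PER-LEVEL PERIOD-FREE PRODUCT LAWS.**  Exactly p543486's
`responseMoments_of_quadratic_and_influence` ((split) for all exteriors against `A₀ + Q + influenceAt 𝔟 ε kmax`; (EM_Q); per odd torus and
cyclically separated family: weights `w γ ≥ 0` on the family shell with TOTAL density budget `Σ_γ familyCoeff i γ · w γ ≤ W`), EXCEPT that the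
product law is asked LEVEL BY LEVEL: for each `k`, `torusE(∏_{γ∈A} 1_{largeFieldEvent 𝔟 (ε β k) γ}) ≤ ∏_{γ∈A} w γ` for the PERIOD-FREE subfamilies
`A` of the level-`k` part of the family shell.  THEN (RM) VERBATIM with the SAME `B = A₀ + max(B_Q, 2e²W)`. [folklore] -/
theorem responseMoments_of_quadratic_and_influence_levelwise (r : LatticeRep (Matrix.specialUnitaryGroup (Fin N) ℂ))
    (a : ℝ → ℝ) (𝔟 : BlockSize) (ε : ℝ → ℕ → ℝ) (kmax : ℝ → ℕ → ℕ) {C₁ β₁ ℓ₁ A₀ B_Q W : ℝ}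
    {p : Fin 4 × Fin 4 → ℝ → ℝ}
    (Q : ℝ → ℕ → Fin 4 × Fin 4 → (Fin 4 → ℤ) → LGConfig 4 (Matrix.specialUnitaryGroup (Fin N) ℂ) → ℝ)
    (MQ : ℝ → ℕ → Fin 4 × Fin 4 → (Fin 4 → ℤ) → ℝ)
    (hQm : ∀ β R q x, Measurable (Q β R q x)) (hQb : ∀ β R q x η, |Q β R q x η| ≤ MQ β R q x)
    (hsplit : ∀ β : ℝ, β₁ ≤ β → ∀ R : ℕ, 1 ≤ R → (R : ℝ) * a β ≤ ℓ₁ →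
      ∀ (q : Fin 4 × Fin 4) (x : Fin 4 → ℤ), q.1 < q.2 → ∀ η : LGConfig 4 (Matrix.specialUnitaryGroup (Fin N) ℂ),
        (R : ℝ) ^ 4 / C₁ * |kerE (Matrix.specialUnitaryGroup (Fin N) ℂ) r β (fun k => x k - (R + 1)) (2 * R + 3) η
          (plane (Matrix.specialUnitaryGroup (Fin N) ℂ) r q x) - p q β| ≤
          A₀ + Q β R q x η + influenceAt (N := N) 𝔟 ε kmax β R q x η)
    (hEMQ : ∀ β : ℝ, β₁ ≤ β → ∀ (L n : ℕ) (q : Fin n → Fin 4 × Fin 4) (x : Fin n → (Fin 4 → ℤ)) (R : ℕ),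
      (∀ i, (q i).1 < (q i).2) → 1 ≤ R → (R : ℝ) * a β ≤ ℓ₁ → 4 * R + 8 ≤ L →
      (∀ i j : Fin n, i ≠ j → ∃ k : Fin 4,
        (2 * (R : ℤ) + 4) ≤ |((((x i k - x j k : ℤ) : ZMod (2 * L + 1))).valMinAbs : ℤ)|) →
      ∀ T : Finset (Fin n),
        torusE (Matrix.specialUnitaryGroup (Fin N) ℂ) r β L
          (fun U => Real.exp (((2 : ℕ) : ℝ) * ∑ i ∈ T, Q β R (q i) (x i) U)) ≤ Real.exp (B_Q * T.card))
    (hW : ∀ β : ℝ, β₁ ≤ β → ∀ (L n : ℕ) (q : Fin n → Fin 4 × Fin 4) (x : Fin n → (Fin 4 → ℤ)) (R : ℕ),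
      (∀ i, (q i).1 < (q i).2) → 1 ≤ R → (R : ℝ) * a β ≤ ℓ₁ → 4 * R + 8 ≤ L →
      (∀ i j : Fin n, i ≠ j → ∃ k : Fin 4,
        (2 * (R : ℤ) + 4) ≤ |((((x i k - x j k : ℤ) : ZMod (2 * L + 1))).valMinAbs : ℤ)|) →
      ∃ w : Polymer → ℝ, (∀ γ ∈ familyShell 𝔟 (kmax β R) R x, 0 ≤ w γ) ∧
        (∀ i, ∑ γ ∈ familyShell 𝔟 (kmax β R) R x, familyCoeff 𝔟 (kmax β R) R x i γ * w γ ≤ W) ∧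
        (∀ k : ℕ, ∀ A, A ⊆ (familyShell 𝔟 (kmax β R) R x).filter (fun γ => γ.k = k) →
          Set.InjOn (fun γ : Polymer => (γ.k, Torus.proj (2 * L + 1) (anchor 𝔟 γ), γ.μ, γ.ν)) ↑A →
          torusE (Matrix.specialUnitaryGroup (Fin N) ℂ) r β L (fun U => ∏ γ ∈ A,
            (largeFieldEvent (N := N) 𝔟 (ε β γ.k) γ).indicator (fun _ => (1 : ℝ)) U) ≤ ∏ γ ∈ A, w γ)) :
    ∀ β : ℝ, β₁ ≤ β → ∀ (L n : ℕ) (q : Fin n → Fin 4 × Fin 4) (x : Fin n → (Fin 4 → ℤ)) (R : ℕ),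
      (∀ i, (q i).1 < (q i).2) → 1 ≤ R → (R : ℝ) * a β ≤ ℓ₁ → 4 * R + 8 ≤ L →
      (∀ i j : Fin n, i ≠ j → ∃ k : Fin 4,
        (2 * (R : ℤ) + 4) ≤ |((((x i k - x j k : ℤ) : ZMod (2 * L + 1))).valMinAbs : ℤ)|) →
      ∀ T : Finset (Fin n),
        torusE (Matrix.specialUnitaryGroup (Fin N) ℂ) r β L (fun U => Real.exp (∑ i ∈ T, (R : ℝ) ^ 4 / C₁ *
          |kerE (Matrix.specialUnitaryGroup (Fin N) ℂ) r β (fun k => x i k - (R + 1)) (2 * R + 3) U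
            (plane (Matrix.specialUnitaryGroup (Fin N) ℂ) r (q i) (x i)) - p (q i) β|)) ≤
          Real.exp ((A₀ + max B_Q (2 * Real.exp (2 * 1) * W)) * T.card) := by
  -- the two carriers as a `Fin 2`-family
  set Y : Fin 2 → ℝ → ℕ → Fin 4 × Fin 4 → (Fin 4 → ℤ) → LGConfig 4 (Matrix.specialUnitaryGroup (Fin N) ℂ) → ℝ :=
    ![Q, influenceAt (N := N) 𝔟 ε kmax] with hYdef
  refine responseMoments_of_carriers_local r a (K := 2) (by norm_num) Y
    (fun β R q x => max (MQ β R q x) (coeffMass 𝔟 (kmax β R) R x)) ?_ ?_ ?_ ?_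
  · intro k β R q x
    fin_cases k
    · simpa [hYdef] using hQm β R q x
    · simpa [hYdef] using measurable_influenceAt (N := N) 𝔟 ε kmax β R q x
  · intro k β R q x η
    fin_cases k
    · simpa [hYdef] using (hQb β R q x η).trans (le_max_left _ _)
    · simpa [hYdef] using (abs_influenceAt_le (N := N) 𝔟 ε kmax β R q x η).trans (le_max_right _ _)
  · intro β hβ R hR hRa q x hq η
    have h := hsplit β hβ R hR hRa q x hq η
    simpa [hYdef, Fin.sum_univ_two, add_assoc] using h
  · intro k β hβ L n q x R hq hR hRa hRL hsep T
    fin_cases k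
    · -- the quadratic carrier
      have h := hEMQ β hβ L n q x R hq hR hRa hRL hsep T
      refine (le_of_eq ?_).trans (h.trans (Real.exp_le_exp.2 ?_))
      · simp [hYdef]
      · exact mul_le_mul_of_nonneg_right (le_max_left _ _) (Nat.cast_nonneg _)
    · -- the large-field carrier, level by level
      obtain ⟨w, hw0, hwW, hpl⟩ := hW β hβ L n q x R hq hR hRa hRL hsep
      have h := torusE_exp_two_mul_sum_influence_le_of_levelwise (N := N) r 𝔟 (ε β) (kmax β R) R L β x hRL hsep
        w hw0 hwW hpl T
      refine (le_of_eq ?_).trans (h.trans (Real.exp_le_exp.2 ?_))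
      · simp [hYdef, influenceAt_eq]
      · exact mul_le_mul_of_nonneg_right (le_max_right _ _) (Nat.cast_nonneg _)

end Influence

/-! ## §3 At the registered stub (SU(2), fundamental representation, unit of record) -/

section Unit

/-- **The body of `stub_responseMomentsOdd6` from the (β) split with tempered-d1's influence functional and PER-LEVEL period-free product
laws.**  `SU(2)`, fundamental representation, a unit `a ≤ c·uRec` eventually: (split with `Q + influenceAt 𝔟 ε kmax`) + (EM_Q) + (weights with
total density budget `W` and, level by level, the product law for the period-free subfamilies of that level of the family shell of every odd
torus) ⇒ the registered conclusion with `B = A₀ + max(B_Q, 2e²W)`.  A closer along (β) ends with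
`exact responseMomentsOdd6_of_quadratic_and_influence_levelwise …`; at level `0` the law is the tree's p530009. [folklore] -/
theorem responseMomentsOdd6_of_quadratic_and_influence_levelwise {a : ℝ → ℝ} {c C₁ β₁ ℓ₁ A₀ B_Q W P₀ : ℝ}
    {p : Fin 4 × Fin 4 → ℝ → ℝ} (hc : 0 < c) (hle : ∀ᶠ β in atTop, a β ≤ c * Transport.uRec β) (hℓ₁ : 0 < ℓ₁)
    (hC₁ : 0 < C₁) (hp : ∀ q β, |p q β| ≤ P₀) (𝔟 : BlockSize) (ε : ℝ → ℕ → ℝ) (kmax : ℝ → ℕ → ℕ)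
    (Q : ℝ → ℕ → Fin 4 × Fin 4 → (Fin 4 → ℤ) → LGConfig 4 (Matrix.specialUnitaryGroup (Fin 2) ℂ) → ℝ)
    (MQ : ℝ → ℕ → Fin 4 × Fin 4 → (Fin 4 → ℤ) → ℝ)
    (hQm : ∀ β R q x, Measurable (Q β R q x)) (hQb : ∀ β R q x η, |Q β R q x η| ≤ MQ β R q x)
    (hsplit : ∀ β : ℝ, β₁ ≤ β → ∀ R : ℕ, 1 ≤ R → (R : ℝ) * a β ≤ ℓ₁ →
      ∀ (q : Fin 4 × Fin 4) (x : Fin 4 → ℤ), q.1 < q.2 → ∀ η : LGConfig 4 (Matrix.specialUnitaryGroup (Fin 2) ℂ),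
        (R : ℝ) ^ 4 / C₁ * |kerE (Matrix.specialUnitaryGroup (Fin 2) ℂ) (fundamentalLatticeRep 2) β (fun k => x k - (R + 1))
          (2 * R + 3) η (plane (Matrix.specialUnitaryGroup (Fin 2) ℂ) (fundamentalLatticeRep 2) q x) - p q β| ≤
          A₀ + Q β R q x η + influenceAt (N := 2) 𝔟 ε kmax β R q x η)
    (hEMQ : ∀ β : ℝ, β₁ ≤ β → ∀ (L n : ℕ) (q : Fin n → Fin 4 × Fin 4) (x : Fin n → (Fin 4 → ℤ)) (R : ℕ),
      (∀ i, (q i).1 < (q i).2) → 1 ≤ R → (R : ℝ) * a β ≤ ℓ₁ → 4 * R + 8 ≤ L →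
      (∀ i j : Fin n, i ≠ j → ∃ k : Fin 4,
        (2 * (R : ℤ) + 4) ≤ |((((x i k - x j k : ℤ) : ZMod (2 * L + 1))).valMinAbs : ℤ)|) →
      ∀ T : Finset (Fin n),
        torusE (Matrix.specialUnitaryGroup (Fin 2) ℂ) (fundamentalLatticeRep 2) β L
          (fun U => Real.exp (((2 : ℕ) : ℝ) * ∑ i ∈ T, Q β R (q i) (x i) U)) ≤ Real.exp (B_Q * T.card))
    (hW : ∀ β : ℝ, β₁ ≤ β → ∀ (L n : ℕ) (q : Fin n → Fin 4 × Fin 4) (x : Fin n → (Fin 4 → ℤ)) (R : ℕ),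
      (∀ i, (q i).1 < (q i).2) → 1 ≤ R → (R : ℝ) * a β ≤ ℓ₁ → 4 * R + 8 ≤ L →
      (∀ i j : Fin n, i ≠ j → ∃ k : Fin 4,
        (2 * (R : ℤ) + 4) ≤ |((((x i k - x j k : ℤ) : ZMod (2 * L + 1))).valMinAbs : ℤ)|) →
      ∃ w : Polymer → ℝ, (∀ γ ∈ familyShell 𝔟 (kmax β R) R x, 0 ≤ w γ) ∧
        (∀ i, ∑ γ ∈ familyShell 𝔟 (kmax β R) R x, familyCoeff 𝔟 (kmax β R) R x i γ * w γ ≤ W) ∧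
        (∀ k : ℕ, ∀ A, A ⊆ (familyShell 𝔟 (kmax β R) R x).filter (fun γ => γ.k = k) →
          Set.InjOn (fun γ : Polymer => (γ.k, Torus.proj (2 * L + 1) (anchor 𝔟 γ), γ.μ, γ.ν)) ↑A →
          torusE (Matrix.specialUnitaryGroup (Fin 2) ℂ) (fundamentalLatticeRep 2) β L (fun U => ∏ γ ∈ A,
            (largeFieldEvent (N := 2) 𝔟 (ε β γ.k) γ).indicator (fun _ => (1 : ℝ)) U) ≤ ∏ γ ∈ A, w γ)) :
    ∃ (a : ℝ → ℝ) (c : ℝ) (C₁ B β₁ ℓ₁ P₀ : ℝ) (p : Fin 4 × Fin 4 → ℝ → ℝ), 0 < c ∧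
      (∀ᶠ β in atTop, a β ≤ c * Transport.uRec β) ∧ 0 < ℓ₁ ∧ 0 < C₁ ∧ (∀ q β, |p q β| ≤ P₀) ∧
      ∀ β : ℝ, β₁ ≤ β → ∀ (L n : ℕ) (q : Fin n → Fin 4 × Fin 4) (x : Fin n → (Fin 4 → ℤ)) (R : ℕ),
        (∀ i, (q i).1 < (q i).2) → 1 ≤ R → (R : ℝ) * a β ≤ ℓ₁ → 4 * R + 8 ≤ L →
        (∀ i j : Fin n, i ≠ j → ∃ k : Fin 4,
          (2 * (R : ℤ) + 4) ≤ |((((x i k - x j k : ℤ) : ZMod (2 * L + 1))).valMinAbs : ℤ)|) →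
        ∀ T : Finset (Fin n),
          torusE (Matrix.specialUnitaryGroup (Fin 2) ℂ) (fundamentalLatticeRep 2) β L
            (fun U => Real.exp (∑ i ∈ T, (R : ℝ) ^ 4 / C₁ *
              |kerE (Matrix.specialUnitaryGroup (Fin 2) ℂ) (fundamentalLatticeRep 2) β (fun k => x i k - (R + 1)) (2 * R + 3) U
                (plane (Matrix.specialUnitaryGroup (Fin 2) ℂ) (fundamentalLatticeRep 2) (q i) (x i)) - p (q i) β|)) ≤
            Real.exp (B * T.card) :=
  ⟨a, c, C₁, A₀ + max B_Q (2 * Real.exp (2 * 1) * W), β₁, ℓ₁, P₀, p, hc, hle, hℓ₁, hC₁, hp,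
    responseMoments_of_quadratic_and_influence_levelwise (N := 2) (fundamentalLatticeRep 2) a 𝔟 ε kmax Q MQ hQm hQb hsplit
      hEMQ hW⟩

end Unit

end Summit.QuantumFields.YangMills.Cruxes.UVSeamRec.TemperedResponse

end
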